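import Literature.Probability.RandomPlanarGeometry.HexSAWBrickWallStripFugacityWidthOneJointContactLDP
import Literature.Probability.Entropy.FiniteShannon
import Mathlib.Analysis.SpecialFunctions.BinaryEntropy
import HarnessLib

/-!
# The two-density contact entropy is a sum of two binary entropies; its continuous extension to the closed triangle

Child module of `HexSAWBrickWallStripFugacityWidthOneJointContactLDP.lean` (§8: the two-density contact entropy `s = contactEntropy₂` of the
width-one two-wall strip in closed form, `contactEntropy₂_eq`).  Write `ρ = 1 − 2a − 2a'` (the rung density of the pair `(a,a')`),
`P = 4a + 2a' − 1`, `Q = 2a + 4a' − 1`, so that `P + ρ = 2a`, `Q + ρ = 2a'` and the open density triangle is `T = {ρ > 0, P > 0, Q > 0}`.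
* §1 ★★★ **BINARY-ENTROPY FORM**: on `T`, `s(a,a') = a·H(ρ/2a) + a'·H(ρ/2a')` with `H` the binary entropy (nats) — equivalently
  `s = negMulLog ρ + (negMulLog P + negMulLog Q − negMulLog 2a − negMulLog 2a')/2`, a signed mixture of five `x log x` terms.
* §2 consequences on `T`: `s > 0` everywhere on the open triangle; `s ≤ (a + a')·log 2 < (log 2)/2`; the diagonal `s(a,a) = 2a·H((1−4a)/2a)`.
* §3 ★★★ **CONTINUOUS EXTENSION TO THE CLOSED TRIANGLE**: the five-term form is continuous on all of `ℝ²`, so `s` has a two-variable limit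
  at EVERY point of the closed triangle (`tendsto_contactEntropy₂_nhdsWithin`); boundary values: the limit is `0` on the whole closed
  ADSORBED edge `a + a' = ½` — in particular at the vertices `(½,0)` and `(0,½)`, as two-variable limits — and at the ZIGZAG vertex
  `(1/6,1/6)`; on the REPELLING edge `4a + 2a' = 1` it is `c·H((½ − c)/2c)` at `((1−2c)/4, c)`, `1/6 < c < ½` (mirror edge by symmetry).
* §4 ★★ **THE ZERO SET**: on the closed triangle the extension is `≥ 0` (subadditivity of `negMulLog`) and vanishes EXACTLY on the adsorbed
  edge and at the zigzag vertex (strict subadditivity); hence `s → 0` at a point of the closed triangle iff the point is on the adsorbed edge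
  or is `(1/6,1/6)` (`tendsto_contactEntropy₂_zero_iff`).
These turn the one-parameter boundary limits of `…ContactEntropyVertex` (along the diagonal / along lines of slope −1 / horizontally) into
genuine two-variable limits within `T`, and settle the two vertices `(½,0)`, `(0,½)` it left open.

## Sources
JansevanRensburg2000 §3.2–§3.3 (1st ed., OUP 2000, the held text: the density function as a Legendre transform and its behaviour at the ends
of its interval); DemboZeitouni2010 §2.2 (rate functions of relative-entropy form).  Mathlib's `Real.binEntropy`, `Real.negMulLog`.
Nothing quoted AS PRINTED; the identity and the statements are this lineage's (elementary algebra on `contactEntropy₂_eq`).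
-/

noncomputable section

open Filter Topology Finset Literature.Probability.LatticeModels Literature.Probability.Percolation SimpleGraph

namespace Literature.Probability.RandomPlanarGeometry.SAW.HexBW

open WidthOneYZ Real

/-! ## §1 The binary-entropy form -/

/-- ★★★ **FIVE-TERM FORM**: on the open density triangle,
`s(a,a') = negMulLog(1−2a−2a') + [negMulLog(4a+2a'−1) + negMulLog(2a+4a'−1) − negMulLog(2a) − negMulLog(2a')]/2`
(`negMulLog x = −x log x`).  [cite: JansevanRensburg2000, §3.2 Theorem 3.19 (1st ed., p. 52: the density function; here made explicit for the two-wall width-one strip)] -/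
theorem contactEntropy₂_eq_negMulLog {a a' : ℝ} (h1 : a + a' < 1 / 2) (h2 : 1 < 4 * a + 2 * a') (h3 : 1 < 2 * a + 4 * a') :
    contactEntropy₂ a a' = negMulLog (1 - 2 * a - 2 * a') +
      (negMulLog (4 * a + 2 * a' - 1) + negMulLog (2 * a + 4 * a' - 1) - negMulLog (2 * a) - negMulLog (2 * a')) / 2 := by
  have ha : 0 < a := by linarith
  have ha' : 0 < a' := by linarith
  have hρ : 0 < 1 - 2 * a - 2 * a' := by linarith
  have hP : 0 < 4 * a + 2 * a' - 1 := by linarith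
  have hQ : 0 < 2 * a + 4 * a' - 1 := by linarith
  have h2a : (0 : ℝ) < 2 * a := by linarith
  have h2a' : (0 : ℝ) < 2 * a' := by linarith
  rw [contactEntropy₂_eq h1 h2 h3]
  -- the three logarithms in atoms `log P`, `log Q`, `log ρ`, `log 2a`, `log 2a'`
  have eY : eosY a a' = (4 * a + 2 * a' - 1) ^ 2 * (2 * a + 4 * a' - 1) / ((2 * a) * (1 - 2 * a - 2 * a') ^ 2) := by
    unfold eosY; ring
  have eZ : eosY a' a = (2 * a + 4 * a' - 1) ^ 2 * (4 * a + 2 * a' - 1) / ((2 * a') * (1 - 2 * a - 2 * a') ^ 2) := by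
    unfold eosY; ring
  have lY : Real.log (eosY a a') = 2 * Real.log (4 * a + 2 * a' - 1) + Real.log (2 * a + 4 * a' - 1) -
      (Real.log (2 * a) + 2 * Real.log (1 - 2 * a - 2 * a')) := by
    rw [eY, Real.log_div (by positivity) (by positivity), Real.log_mul (by positivity) (by positivity), Real.log_pow,
      Real.log_mul (by positivity) (by positivity), Real.log_pow]
    push_cast; ring
  have lZ : Real.log (eosY a' a) = 2 * Real.log (2 * a + 4 * a' - 1) + Real.log (4 * a + 2 * a' - 1) -
      (Real.log (2 * a') + 2 * Real.log (1 - 2 * a - 2 * a')) := by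
    rw [eZ, Real.log_div (by positivity) (by positivity), Real.log_mul (by positivity) (by positivity), Real.log_pow,
      Real.log_mul (by positivity) (by positivity), Real.log_pow]
    push_cast; ring
  have lM : Real.log ((4 * a + 2 * a' - 1) * (2 * a + 4 * a' - 1) / (1 - 2 * a - 2 * a') ^ 2) =
      Real.log (4 * a + 2 * a' - 1) + Real.log (2 * a + 4 * a' - 1) - 2 * Real.log (1 - 2 * a - 2 * a') := by
    rw [Real.log_div (by positivity) (by positivity), Real.log_mul (by positivity) (by positivity), Real.log_pow]
    push_cast; ring
  rw [lY, lZ, lM]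
  simp only [negMulLog]
  ring

/-- ★★★ **BINARY-ENTROPY FORM**: on the open density triangle, with `ρ = 1 − 2a − 2a'`,
`s(a,a') = a·H(ρ/(2a)) + a'·H(ρ/(2a'))`, `H(p) = −p log p − (1−p) log(1−p)` the binary entropy (Mathlib `Real.binEntropy`):
the two-density entropy splits into a bottom part and a top part, each a binary entropy at the rung-to-contact ratio.
[cite: JansevanRensburg2000, §3.2 Theorem 3.19 (1st ed., p. 52); DemboZeitouni2010, §2.2 (lane statement)] -/
theorem contactEntropy₂_eq_binEntropy {a a' : ℝ} (h1 : a + a' < 1 / 2) (h2 : 1 < 4 * a + 2 * a') (h3 : 1 < 2 * a + 4 * a') :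
    contactEntropy₂ a a' = a * binEntropy ((1 - 2 * a - 2 * a') / (2 * a)) + a' * binEntropy ((1 - 2 * a - 2 * a') / (2 * a')) := by
  have ha : 0 < a := by linarith
  have ha' : 0 < a' := by linarith
  have hρ : 0 < 1 - 2 * a - 2 * a' := by linarith
  have hP : 0 < 4 * a + 2 * a' - 1 := by linarith
  have hQ : 0 < 2 * a + 4 * a' - 1 := by linarith
  have h2a : (0 : ℝ) < 2 * a := by linarith
  have h2a' : (0 : ℝ) < 2 * a' := by linarith
  rw [contactEntropy₂_eq_negMulLog h1 h2 h3]
  unfold binEntropy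
  have e1 : 1 - (1 - 2 * a - 2 * a') / (2 * a) = (4 * a + 2 * a' - 1) / (2 * a) := by field_simp; ring
  have e2 : 1 - (1 - 2 * a - 2 * a') / (2 * a') = (2 * a + 4 * a' - 1) / (2 * a') := by field_simp; ring
  rw [e1, e2, inv_div, inv_div, inv_div, inv_div, Real.log_div h2a.ne' hρ.ne', Real.log_div h2a.ne' hP.ne',
    Real.log_div h2a'.ne' hρ.ne', Real.log_div h2a'.ne' hQ.ne']
  simp only [negMulLog]
  field_simp
  ring

/-! ## §2 Consequences on the open triangle -/

/-- ★★ **POSITIVITY**: the two-density entropy is STRICTLY POSITIVE at every point of the open density triangle (both binary entropies are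
taken at a ratio in `(0,1)`).  [cite: JansevanRensburg2000, §3.3 (1st ed.: positivity of the density function inside its interval; lane statement for the pair)] -/
theorem contactEntropy₂_pos {a a' : ℝ} (h1 : a + a' < 1 / 2) (h2 : 1 < 4 * a + 2 * a') (h3 : 1 < 2 * a + 4 * a') :
    0 < contactEntropy₂ a a' := by
  have ha : 0 < a := by linarith
  have ha' : 0 < a' := by linarith
  rw [contactEntropy₂_eq_binEntropy h1 h2 h3]
  have k1 : 0 < (1 - 2 * a - 2 * a') / (2 * a) := div_pos (by linarith) (by linarith)
  have k2 : (1 - 2 * a - 2 * a') / (2 * a) < 1 := by rw [div_lt_one (by linarith)]; linarith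
  have k3 : 0 < (1 - 2 * a - 2 * a') / (2 * a') := div_pos (by linarith) (by linarith)
  have k4 : (1 - 2 * a - 2 * a') / (2 * a') < 1 := by rw [div_lt_one (by linarith)]; linarith
  have b1 := binEntropy_pos k1 k2
  have b2 := binEntropy_pos k3 k4
  positivity

/-- ★ **A universal bound**: `s(a,a') ≤ (a + a')·log 2` and hence `s(a,a') < (log 2)/2` on the open triangle (each binary entropy is at most
`log 2`). [cite: DemboZeitouni2010, §2.2 (lane statement)] -/
theorem contactEntropy₂_le_mul_log_two {a a' : ℝ} (h1 : a + a' < 1 / 2) (h2 : 1 < 4 * a + 2 * a') (h3 : 1 < 2 * a + 4 * a') :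
    contactEntropy₂ a a' ≤ (a + a') * Real.log 2 ∧ contactEntropy₂ a a' < Real.log 2 / 2 := by
  have ha : 0 < a := by linarith
  have ha' : 0 < a' := by linarith
  have hl2 : 0 < Real.log 2 := Real.log_pos (by norm_num)
  have e := contactEntropy₂_eq_binEntropy h1 h2 h3
  have b1 : binEntropy ((1 - 2 * a - 2 * a') / (2 * a)) ≤ Real.log 2 := binEntropy_le_log_two
  have b2 : binEntropy ((1 - 2 * a - 2 * a') / (2 * a')) ≤ Real.log 2 := binEntropy_le_log_two
  have k : contactEntropy₂ a a' ≤ (a + a') * Real.log 2 := by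
    rw [e]
    nlinarith [mul_le_mul_of_nonneg_left b1 ha.le, mul_le_mul_of_nonneg_left b2 ha'.le]
  refine ⟨k, lt_of_le_of_lt k ?_⟩
  nlinarith

/-- ★ The diagonal: `s(a,a) = 2a·H((1−4a)/(2a))` for `1/6 < a < 1/4`. [cite: JansevanRensburg2000, §3.2 Theorem 3.19 (1st ed., p. 52; lane statement)] -/
theorem contactEntropy₂_diag_binEntropy {a : ℝ} (h1 : 1 / 6 < a) (h2 : a < 1 / 4) :
    contactEntropy₂ a a = 2 * a * binEntropy ((1 - 4 * a) / (2 * a)) := by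
  rw [contactEntropy₂_eq_binEntropy (by linarith) (by linarith) (by linarith)]
  have e : 1 - 2 * a - 2 * a = 1 - 4 * a := by ring
  rw [e]; ring

/-- ★ The point `(1/5, 1/5)` (one rung per two contacts on each wall): `s(1/5,1/5) = (2/5)·log 2` — the only point of the triangle where
the bound `s ≤ (a + a')·log 2` is attained (both binary entropies at `½`). [cite: DemboZeitouni2010, §2.2 (lane statement)] -/
theorem contactEntropy₂_fifth_fifth : contactEntropy₂ (1 / 5) (1 / 5) = 2 / 5 * Real.log 2 := by
  rw [contactEntropy₂_diag_binEntropy (by norm_num) (by norm_num)]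
  have e : ((1 : ℝ) - 4 * (1 / 5)) / (2 * (1 / 5)) = 2⁻¹ := by norm_num
  rw [e, binEntropy_two_inv]; ring

/-! ## §3 The continuous extension to the closed triangle and the boundary values -/

/-- The five-term form is continuous on all of `ℝ²` (`negMulLog` is continuous). [cite: DemboZeitouni2010, §2.2 (lane plumbing)] -/
theorem continuous_contactEntropy₂Ext :
    Continuous (fun p : ℝ × ℝ => negMulLog (1 - 2 * p.1 - 2 * p.2) +
      (negMulLog (4 * p.1 + 2 * p.2 - 1) + negMulLog (2 * p.1 + 4 * p.2 - 1) - negMulLog (2 * p.1) - negMulLog (2 * p.2)) / 2) := by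
  have hc := continuous_negMulLog
  have h1 : Continuous (fun p : ℝ × ℝ => 1 - 2 * p.1 - 2 * p.2) := by fun_prop
  have h2 : Continuous (fun p : ℝ × ℝ => 4 * p.1 + 2 * p.2 - 1) := by fun_prop
  have h3 : Continuous (fun p : ℝ × ℝ => 2 * p.1 + 4 * p.2 - 1) := by fun_prop
  have h4 : Continuous (fun p : ℝ × ℝ => 2 * p.1) := by fun_prop
  have h5 : Continuous (fun p : ℝ × ℝ => 2 * p.2) := by fun_prop
  exact (hc.comp h1).add (((((hc.comp h2).add (hc.comp h3)).sub (hc.comp h4)).sub (hc.comp h5)).div_const 2)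

/-- ★★★ **THE TWO-VARIABLE LIMIT AT EVERY POINT OF THE CLOSED TRIANGLE**: for every `(v₁,v₂) ∈ ℝ²`, as `(a,a') → (v₁,v₂)` WITHIN the open
density triangle, `s(a,a') → negMulLog(1−2v₁−2v₂) + [negMulLog(4v₁+2v₂−1) + negMulLog(2v₁+4v₂−1) − negMulLog(2v₁) − negMulLog(2v₂)]/2`
— the entropy extends continuously to the closure of the triangle (the statement is vacuous off the closure).
[cite: JansevanRensburg2000, §3.3 (1st ed.: continuity of the density function up to the ends of its interval; lane statement for the pair); DemboZeitouni2010, §2.2] -/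
theorem tendsto_contactEntropy₂_nhdsWithin (v₁ v₂ : ℝ) :
    Tendsto (fun p : ℝ × ℝ => contactEntropy₂ p.1 p.2)
      (𝓝[{p : ℝ × ℝ | p.1 + p.2 < 1 / 2 ∧ 1 < 4 * p.1 + 2 * p.2 ∧ 1 < 2 * p.1 + 4 * p.2}] (v₁, v₂))
      (𝓝 (negMulLog (1 - 2 * v₁ - 2 * v₂) +
        (negMulLog (4 * v₁ + 2 * v₂ - 1) + negMulLog (2 * v₁ + 4 * v₂ - 1) - negMulLog (2 * v₁) - negMulLog (2 * v₂)) / 2)) := by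
  have hc := ((continuous_contactEntropy₂Ext.tendsto (v₁, v₂)).mono_left (nhdsWithin_le_nhds (s :=
    {p : ℝ × ℝ | p.1 + p.2 < 1 / 2 ∧ 1 < 4 * p.1 + 2 * p.2 ∧ 1 < 2 * p.1 + 4 * p.2}) (a := (v₁, v₂))))
  refine hc.congr' ?_
  refine eventually_nhdsWithin_of_forall fun p hp => ?_
  obtain ⟨t1, t2, t3⟩ := hp
  exact (contactEntropy₂_eq_negMulLog t1 t2 t3).symm

/-- ★★★ **THE ADSORBED EDGE IS A ZERO SET, VERTICES INCLUDED**: for EVERY `a₀ ∈ ℝ`, `s(a,a') → 0` as `(a,a') → (a₀, ½ − a₀)` within the open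
triangle — zero entropy on the whole closed adsorbed edge `a + a' = ½` as a two-variable limit; `a₀ = ½` and `a₀ = 0` are the vertices
`(½,0)` and `(0,½)` (the walks glued to one wall), left open by `…ContactEntropyVertex`.
[cite: JansevanRensburg2000, §3.3 (1st ed.: zero entropy at the end of the density interval); DemboZeitouni2010, §2.2 (lane statement)] -/
theorem tendsto_contactEntropy₂_adsorbed (a₀ : ℝ) :
    Tendsto (fun p : ℝ × ℝ => contactEntropy₂ p.1 p.2)
      (𝓝[{p : ℝ × ℝ | p.1 + p.2 < 1 / 2 ∧ 1 < 4 * p.1 + 2 * p.2 ∧ 1 < 2 * p.1 + 4 * p.2}] (a₀, 1 / 2 - a₀)) (𝓝 0) := by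
  have h := tendsto_contactEntropy₂_nhdsWithin a₀ (1 / 2 - a₀)
  have e : negMulLog (1 - 2 * a₀ - 2 * (1 / 2 - a₀)) + (negMulLog (4 * a₀ + 2 * (1 / 2 - a₀) - 1) +
      negMulLog (2 * a₀ + 4 * (1 / 2 - a₀) - 1) - negMulLog (2 * a₀) - negMulLog (2 * (1 / 2 - a₀))) / 2 = 0 := by
    have e1 : (1 : ℝ) - 2 * a₀ - 2 * (1 / 2 - a₀) = 0 := by ring
    have e2 : (4 : ℝ) * a₀ + 2 * (1 / 2 - a₀) - 1 = 2 * a₀ := by ring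
    have e3 : (2 : ℝ) * a₀ + 4 * (1 / 2 - a₀) - 1 = 2 * (1 / 2 - a₀) := by ring
    rw [e1, e2, e3, negMulLog_zero]; ring
  rw [e] at h
  exact h

/-- ★★ The vertex `(½, 0)` (bottom-wall-glued walks): `s → 0` as a two-variable limit within the triangle.
[cite: JansevanRensburg2000, §3.3 (1st ed.; lane statement)] -/
theorem tendsto_contactEntropy₂_vertex_half_zero :
    Tendsto (fun p : ℝ × ℝ => contactEntropy₂ p.1 p.2)
      (𝓝[{p : ℝ × ℝ | p.1 + p.2 < 1 / 2 ∧ 1 < 4 * p.1 + 2 * p.2 ∧ 1 < 2 * p.1 + 4 * p.2}] (1 / 2, 0)) (𝓝 0) := by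
  have h := tendsto_contactEntropy₂_adsorbed (1 / 2)
  have e : (1 : ℝ) / 2 - 1 / 2 = 0 := by norm_num
  rw [e] at h
  exact h

/-- ★★ The vertex `(0, ½)` (top-wall-glued walks): `s → 0` as a two-variable limit within the triangle.
[cite: JansevanRensburg2000, §3.3 (1st ed.; lane statement)] -/
theorem tendsto_contactEntropy₂_vertex_zero_half :
    Tendsto (fun p : ℝ × ℝ => contactEntropy₂ p.1 p.2)
      (𝓝[{p : ℝ × ℝ | p.1 + p.2 < 1 / 2 ∧ 1 < 4 * p.1 + 2 * p.2 ∧ 1 < 2 * p.1 + 4 * p.2}] (0, 1 / 2)) (𝓝 0) := by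
  have h := tendsto_contactEntropy₂_adsorbed 0
  have e : (1 : ℝ) / 2 - 0 = 1 / 2 := by norm_num
  rw [e] at h
  exact h

/-- ★★ The zigzag vertex `(1/6, 1/6)` as a TWO-VARIABLE limit: `s → 0` as `(a,a') → (1/6,1/6)` within the triangle (the diagonal limit of
`…ContactEntropyVertex` §1, now in every direction). [cite: JansevanRensburg2000, §3.3 (1st ed.; lane statement)] -/
theorem tendsto_contactEntropy₂_zigzag₂ :
    Tendsto (fun p : ℝ × ℝ => contactEntropy₂ p.1 p.2)
      (𝓝[{p : ℝ × ℝ | p.1 + p.2 < 1 / 2 ∧ 1 < 4 * p.1 + 2 * p.2 ∧ 1 < 2 * p.1 + 4 * p.2}] (1 / 6, 1 / 6)) (𝓝 0) := by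
  have h := tendsto_contactEntropy₂_nhdsWithin (1 / 6) (1 / 6)
  have e : negMulLog (1 - 2 * (1 / 6 : ℝ) - 2 * (1 / 6)) + (negMulLog (4 * (1 / 6 : ℝ) + 2 * (1 / 6) - 1) +
      negMulLog (2 * (1 / 6 : ℝ) + 4 * (1 / 6) - 1) - negMulLog (2 * (1 / 6 : ℝ)) - negMulLog (2 * (1 / 6 : ℝ))) / 2 = 0 := by
    have e1 : (1 : ℝ) - 2 * (1 / 6) - 2 * (1 / 6) = 1 / 3 := by norm_num
    have e2 : (4 : ℝ) * (1 / 6) + 2 * (1 / 6) - 1 = 0 := by norm_num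
    have e3 : (2 : ℝ) * (1 / 6) + 4 * (1 / 6) - 1 = 0 := by norm_num
    have e4 : (2 : ℝ) * (1 / 6) = 1 / 3 := by norm_num
    rw [e1, e2, e3, e4, negMulLog_zero]; ring
  rw [e] at h
  exact h

/-- The value of the five-term form on the repelling edge `4a + 2a' = 1`, `1/6 < c < ½`: `c·H((½ − c)/(2c))`.
[cite: JansevanRensburg2000, §3.3 (1st ed.; lane plumbing)] -/
theorem repellingEdge_ext_eq {c : ℝ} (hc1 : 1 / 6 < c) (hc2 : c < 1 / 2) :
    negMulLog (1 / 2 - c) + (negMulLog (3 * c - 1 / 2) - negMulLog (1 / 2 - c) - negMulLog (2 * c)) / 2 =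
      c * binEntropy ((1 / 2 - c) / (2 * c)) := by
  have hS : (0 : ℝ) < 1 / 2 - c := by linarith
  have hR : (0 : ℝ) < 3 * c - 1 / 2 := by linarith
  have h2c : (0 : ℝ) < 2 * c := by linarith
  unfold binEntropy
  have f1 : 1 - (1 / 2 - c) / (2 * c) = (3 * c - 1 / 2) / (2 * c) := by field_simp; ring
  rw [f1, inv_div, inv_div, Real.log_div h2c.ne' hS.ne', Real.log_div h2c.ne' hR.ne']
  simp only [negMulLog]
  field_simp
  ring

/-- ★★ **THE REPELLING EDGE `4a + 2a' = 1` AS A TWO-VARIABLE LIMIT**: for `1/6 < c < ½`, as `(a,a') → ((1−2c)/4, c)` within the triangle,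
`s(a,a') → c·H((½ − c)/(2c)) > 0` — the binary-entropy residual of `…ContactEntropyVertex` §4 (there along horizontal lines), in every
direction. [cite: JansevanRensburg2000, §3.3 (1st ed.; lane statement); DemboZeitouni2010, §2.2] -/
theorem tendsto_contactEntropy₂_repelling₂ {c : ℝ} (hc1 : 1 / 6 < c) (hc2 : c < 1 / 2) :
    Tendsto (fun p : ℝ × ℝ => contactEntropy₂ p.1 p.2)
      (𝓝[{p : ℝ × ℝ | p.1 + p.2 < 1 / 2 ∧ 1 < 4 * p.1 + 2 * p.2 ∧ 1 < 2 * p.1 + 4 * p.2}] ((1 - 2 * c) / 4, c))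
      (𝓝 (c * binEntropy ((1 / 2 - c) / (2 * c)))) := by
  have h := tendsto_contactEntropy₂_nhdsWithin ((1 - 2 * c) / 4) c
  have e : negMulLog (1 - 2 * ((1 - 2 * c) / 4) - 2 * c) + (negMulLog (4 * ((1 - 2 * c) / 4) + 2 * c - 1) +
      negMulLog (2 * ((1 - 2 * c) / 4) + 4 * c - 1) - negMulLog (2 * ((1 - 2 * c) / 4)) - negMulLog (2 * c)) / 2 =
      c * binEntropy ((1 / 2 - c) / (2 * c)) := by
    have e1 : (1 : ℝ) - 2 * ((1 - 2 * c) / 4) - 2 * c = 1 / 2 - c := by ring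
    have e2 : (4 : ℝ) * ((1 - 2 * c) / 4) + 2 * c - 1 = 0 := by ring
    have e3 : (2 : ℝ) * ((1 - 2 * c) / 4) + 4 * c - 1 = 3 * c - 1 / 2 := by ring
    have e4 : (2 : ℝ) * ((1 - 2 * c) / 4) = 1 / 2 - c := by ring
    rw [e1, e2, e3, e4, negMulLog_zero, zero_add]
    exact repellingEdge_ext_eq hc1 hc2
  rw [e] at h
  exact h

/-- ★★ The mirror repelling edge `2a + 4a' = 1`: for `1/6 < c < ½`, as `(a,a') → (c, (1−2c)/4)` within the triangle,
`s → c·H((½ − c)/(2c))`. [cite: JansevanRensburg2000, §3.3 (1st ed.; lane statement)] -/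
theorem tendsto_contactEntropy₂_repelling₂' {c : ℝ} (hc1 : 1 / 6 < c) (hc2 : c < 1 / 2) :
    Tendsto (fun p : ℝ × ℝ => contactEntropy₂ p.1 p.2)
      (𝓝[{p : ℝ × ℝ | p.1 + p.2 < 1 / 2 ∧ 1 < 4 * p.1 + 2 * p.2 ∧ 1 < 2 * p.1 + 4 * p.2}] (c, (1 - 2 * c) / 4))
      (𝓝 (c * binEntropy ((1 / 2 - c) / (2 * c)))) := by
  have h := tendsto_contactEntropy₂_nhdsWithin c ((1 - 2 * c) / 4)
  have e : negMulLog (1 - 2 * c - 2 * ((1 - 2 * c) / 4)) + (negMulLog (4 * c + 2 * ((1 - 2 * c) / 4) - 1) +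
      negMulLog (2 * c + 4 * ((1 - 2 * c) / 4) - 1) - negMulLog (2 * c) - negMulLog (2 * ((1 - 2 * c) / 4))) / 2 =
      c * binEntropy ((1 / 2 - c) / (2 * c)) := by
    have e1 : (1 : ℝ) - 2 * c - 2 * ((1 - 2 * c) / 4) = 1 / 2 - c := by ring
    have e2 : (4 : ℝ) * c + 2 * ((1 - 2 * c) / 4) - 1 = 3 * c - 1 / 2 := by ring
    have e3 : (2 : ℝ) * c + 4 * ((1 - 2 * c) / 4) - 1 = 0 := by ring
    have e4 : (2 : ℝ) * ((1 - 2 * c) / 4) = 1 / 2 - c := by ring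
    rw [e1, e2, e3, e4, negMulLog_zero, add_zero, ← repellingEdge_ext_eq hc1 hc2]
    ring
  rw [e] at h
  exact h

/-- ★ The repelling-edge limit value is POSITIVE for `1/6 < c < ½` (and vanishes at both ends of the edge).
[cite: JansevanRensburg2000, §3.3 (1st ed.; lane statement)] -/
theorem repelling₂_limit_pos {c : ℝ} (hc1 : 1 / 6 < c) (hc2 : c < 1 / 2) :
    0 < c * binEntropy ((1 / 2 - c) / (2 * c)) := by
  have hc : 0 < c := by linarith
  have k1 : 0 < (1 / 2 - c) / (2 * c) := div_pos (by linarith) (by linarith)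
  have k2 : (1 / 2 - c) / (2 * c) < 1 := by rw [div_lt_one (by linarith)]; linarith
  exact mul_pos hc (binEntropy_pos k1 k2)

/-! ## §4 The extension on the closed triangle: nonnegativity and the zero set -/

/-- Strict subadditivity of `negMulLog` on `(0,∞)`: `negMulLog (x + y) < negMulLog x + negMulLog y` for `x, y > 0`
(`x log x` is strictly superadditive). [cite: DemboZeitouni2010, §2.2 (lane plumbing)] -/
theorem negMulLog_add_lt_of_pos {x y : ℝ} (hx : 0 < x) (hy : 0 < y) : negMulLog (x + y) < negMulLog x + negMulLog y := by
  simp only [negMulLog]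
  have h1 : Real.log x < Real.log (x + y) := Real.log_lt_log hx (by linarith)
  have h2 : Real.log y < Real.log (x + y) := Real.log_lt_log hy (by linarith)
  have k1 := mul_lt_mul_of_pos_left h1 hx
  have k2 := mul_lt_mul_of_pos_left h2 hy
  have e : (x + y) * Real.log (x + y) = x * Real.log (x + y) + y * Real.log (x + y) := by ring
  nlinarith

/-- ★★ **NONNEGATIVITY OF THE EXTENSION ON THE CLOSED TRIANGLE**: for `v₁ + v₂ ≤ ½`, `4v₁ + 2v₂ ≥ 1`, `2v₁ + 4v₂ ≥ 1` the five-term form is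
`≥ 0` — it is half the sum of the two subadditivity defects `negMulLog P + negMulLog ρ − negMulLog(P + ρ)` and `negMulLog Q + negMulLog ρ − negMulLog(Q + ρ)`
(`P + ρ = 2v₁`, `Q + ρ = 2v₂`; subadditivity of `negMulLog` is the tree's `FiniteShannon.negMulLog_add_le`).
[cite: JansevanRensburg2000, §3.3 (1st ed.: nonnegativity of the density function; lane statement for the pair)] -/
theorem contactEntropy₂Ext_nonneg {v₁ v₂ : ℝ} (h1 : v₁ + v₂ ≤ 1 / 2) (h2 : 1 ≤ 4 * v₁ + 2 * v₂) (h3 : 1 ≤ 2 * v₁ + 4 * v₂) :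
    0 ≤ negMulLog (1 - 2 * v₁ - 2 * v₂) +
      (negMulLog (4 * v₁ + 2 * v₂ - 1) + negMulLog (2 * v₁ + 4 * v₂ - 1) - negMulLog (2 * v₁) - negMulLog (2 * v₂)) / 2 := by
  have hρ : 0 ≤ 1 - 2 * v₁ - 2 * v₂ := by linarith
  have hP : 0 ≤ 4 * v₁ + 2 * v₂ - 1 := by linarith
  have hQ : 0 ≤ 2 * v₁ + 4 * v₂ - 1 := by linarith
  have k1 := Literature.Probability.Entropy.FiniteShannon.negMulLog_add_le hP hρ
  have k2 := Literature.Probability.Entropy.FiniteShannon.negMulLog_add_le hQ hρ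
  have e1 : 4 * v₁ + 2 * v₂ - 1 + (1 - 2 * v₁ - 2 * v₂) = 2 * v₁ := by ring
  have e2 : 2 * v₁ + 4 * v₂ - 1 + (1 - 2 * v₁ - 2 * v₂) = 2 * v₂ := by ring
  rw [e1] at k1
  rw [e2] at k2
  linarith

/-- ★★ **THE ZERO SET ON THE CLOSED TRIANGLE**: on the closed density triangle the extension vanishes EXACTLY on the adsorbed edge
`v₁ + v₂ = ½` and at the zigzag vertex `(1/6, 1/6)`; everywhere else on the closed triangle (interior, the two repelling edges without their
ends on the adsorbed edge and the zigzag vertex) it is strictly positive.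
[cite: JansevanRensburg2000, §3.3 (1st ed.: the density function vanishes only at the ends of its interval; lane statement for the pair)] -/
theorem contactEntropy₂Ext_eq_zero_iff {v₁ v₂ : ℝ} (h1 : v₁ + v₂ ≤ 1 / 2) (h2 : 1 ≤ 4 * v₁ + 2 * v₂) (h3 : 1 ≤ 2 * v₁ + 4 * v₂) :
    negMulLog (1 - 2 * v₁ - 2 * v₂) +
      (negMulLog (4 * v₁ + 2 * v₂ - 1) + negMulLog (2 * v₁ + 4 * v₂ - 1) - negMulLog (2 * v₁) - negMulLog (2 * v₂)) / 2 = 0 ↔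
    (v₁ + v₂ = 1 / 2 ∨ (v₁ = 1 / 6 ∧ v₂ = 1 / 6)) := by
  have hρ : 0 ≤ 1 - 2 * v₁ - 2 * v₂ := by linarith
  have hP : 0 ≤ 4 * v₁ + 2 * v₂ - 1 := by linarith
  have hQ : 0 ≤ 2 * v₁ + 4 * v₂ - 1 := by linarith
  have e1 : 4 * v₁ + 2 * v₂ - 1 + (1 - 2 * v₁ - 2 * v₂) = 2 * v₁ := by ring
  have e2 : 2 * v₁ + 4 * v₂ - 1 + (1 - 2 * v₁ - 2 * v₂) = 2 * v₂ := by ring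
  constructor
  · intro h0
    by_cases hρ0 : 1 - 2 * v₁ - 2 * v₂ = 0
    · left; linarith
    · right
      have hρ' : 0 < 1 - 2 * v₁ - 2 * v₂ := lt_of_le_of_ne hρ (Ne.symm hρ0)
      have k1 := Literature.Probability.Entropy.FiniteShannon.negMulLog_add_le hP hρ
      have k2 := Literature.Probability.Entropy.FiniteShannon.negMulLog_add_le hQ hρ
      rw [e1] at k1
      rw [e2] at k2
      -- both defects vanish
      have d1 : negMulLog (2 * v₁) = negMulLog (4 * v₁ + 2 * v₂ - 1) + negMulLog (1 - 2 * v₁ - 2 * v₂) := by linarith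
      have d2 : negMulLog (2 * v₂) = negMulLog (2 * v₁ + 4 * v₂ - 1) + negMulLog (1 - 2 * v₁ - 2 * v₂) := by linarith
      have hP0 : 4 * v₁ + 2 * v₂ - 1 = 0 := by
        by_contra hne
        have hP' : 0 < 4 * v₁ + 2 * v₂ - 1 := lt_of_le_of_ne hP (Ne.symm hne)
        have := negMulLog_add_lt_of_pos hP' hρ'
        rw [e1] at this
        linarith
      have hQ0 : 2 * v₁ + 4 * v₂ - 1 = 0 := by
        by_contra hne
        have hQ' : 0 < 2 * v₁ + 4 * v₂ - 1 := lt_of_le_of_ne hQ (Ne.symm hne)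
        have := negMulLog_add_lt_of_pos hQ' hρ'
        rw [e2] at this
        linarith
      constructor <;> linarith
  · rintro (hE | ⟨hv1, hv2⟩)
    · have f1 : 1 - 2 * v₁ - 2 * v₂ = 0 := by linarith
      have f2 : 4 * v₁ + 2 * v₂ - 1 = 2 * v₁ := by linarith
      have f3 : 2 * v₁ + 4 * v₂ - 1 = 2 * v₂ := by linarith
      rw [f1, f2, f3, negMulLog_zero]; ring
    · subst hv1; subst hv2; norm_num; ring

/-- ★★ Consequently the entropy tends to `0` at a point of the closed triangle (approached within the open triangle) IF AND ONLY IF that point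
lies on the adsorbed edge or is the zigzag vertex. [cite: JansevanRensburg2000, §3.3 (1st ed.; lane statement)] -/
theorem tendsto_contactEntropy₂_zero_iff {v₁ v₂ : ℝ} (h1 : v₁ + v₂ ≤ 1 / 2) (h2 : 1 ≤ 4 * v₁ + 2 * v₂) (h3 : 1 ≤ 2 * v₁ + 4 * v₂) :
    Tendsto (fun p : ℝ × ℝ => contactEntropy₂ p.1 p.2)
      (𝓝[{p : ℝ × ℝ | p.1 + p.2 < 1 / 2 ∧ 1 < 4 * p.1 + 2 * p.2 ∧ 1 < 2 * p.1 + 4 * p.2}] (v₁, v₂)) (𝓝 0) ↔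
    (v₁ + v₂ = 1 / 2 ∨ (v₁ = 1 / 6 ∧ v₂ = 1 / 6)) := by
  have h := tendsto_contactEntropy₂_nhdsWithin v₁ v₂
  rw [← contactEntropy₂Ext_eq_zero_iff h1 h2 h3]
  constructor
  · intro h0
    -- the within-filter is not trivial: `(v₁,v₂)` is in the closure of the open triangle
    have hne : (𝓝[{p : ℝ × ℝ | p.1 + p.2 < 1 / 2 ∧ 1 < 4 * p.1 + 2 * p.2 ∧ 1 < 2 * p.1 + 4 * p.2}] (v₁, v₂)).NeBot := by
      refine mem_closure_iff_nhdsWithin_neBot.1 ?_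
      rw [Metric.mem_closure_iff]
      intro ε hε
      -- move from `(v₁,v₂)` towards the centroid `(2/9, 2/9)`
      set t := min (1 / 2 : ℝ) (ε / 2) with ht
      have ht0 : 0 < t := lt_min (by norm_num) (by linarith)
      have ht1 : t ≤ 1 / 2 := min_le_left _ _
      have htε : t ≤ ε / 2 := min_le_right _ _
      refine ⟨(v₁ + t * (2 / 9 - v₁), v₂ + t * (2 / 9 - v₂)), ?_, ?_⟩
      · refine ⟨?_, ?_, ?_⟩ <;> simp only <;> nlinarith
      · rw [Prod.dist_eq, Real.dist_eq, Real.dist_eq]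
        have b1 : |v₁ - (v₁ + t * (2 / 9 - v₁))| < ε := by
          rw [show v₁ - (v₁ + t * (2 / 9 - v₁)) = -(t * (2 / 9 - v₁)) by ring, abs_neg, abs_mul, abs_of_pos ht0]
          have : |2 / 9 - v₁| ≤ 1 := by rw [abs_le]; constructor <;> linarith
          nlinarith
        have b2 : |v₂ - (v₂ + t * (2 / 9 - v₂))| < ε := by
          rw [show v₂ - (v₂ + t * (2 / 9 - v₂)) = -(t * (2 / 9 - v₂)) by ring, abs_neg, abs_mul, abs_of_pos ht0]
          have : |2 / 9 - v₂| ≤ 1 := by rw [abs_le]; constructor <;> linarith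
          nlinarith
        exact max_lt b1 b2
    exact tendsto_nhds_unique h h0 ▸ rfl
  · intro e; rw [e] at h; exact h

end Literature.Probability.RandomPlanarGeometry.SAW.HexBW
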